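import Literature.Probability.LatticeModels.SixVertexSpectralScalingLimit
import Literature.Probability.LatticeModels.SixVertexSpectralMeasureCompactness

/-!
# Passage to the full-plane and scaling limits in the spectral representation
# (DKLM 2026, Part II, Lemma 32 and Lemma 34 — conditional forms)

H. Duminil-Copin, K. K. Kozlowski, P. Lammers, I. Manolescu, *Gaussian free field convergence of
the six-vertex model with `-1 ≤ Δ ≤ -1/2`*, arXiv:2603.06268 (2026) [DKLM2026SixVertexGFF]
(`paper:arxiv-2603.06268`, chunk p0024):

> **Lemma 32.** For any horizontally ordered sequence `u ⊂ ℤ²` with `{y₁,y₂} ∋ 0`, we have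
> `Φ₂(u) = ∫ χ^discr_u(a,b) dμ_∞(a,b)`. Proof. Using the full-plane limit of the six-vertex model
> (Theorem (thm:infinite_volume_6V)), we obtain `Φ₂(u) = lim_L Φ_{CYL_L,2}(u) = lim_L μ_L[χ^discr_u]`.
> Since `μ_L` is supported on `(0,2] × ℝ`, we may insert the indicator `𝟙{a ≤ 2}` […] Because
> `y₁ = 0` or `y₂ = 0`, we have `𝟙{a≤2}·χ^discr_u = O(a ∧ 1/a)` […] Lemma 31 therefore implies that
> `Φ₂(u) = μ_∞[𝟙{a≤2}·χ^discr_u]`. The proof is completed by discarding the indicator, which is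
> justified by the fact that `μ_∞[|a| > 2] = 0` […] by the definition of `𝓜` and a second
> application of Lemma 31.
>
> **Lemma 34** (Spectral representation of the sub-sequential scaling limit). Let `(δ_n)_n` be a
> convergence sequence. Then, for any horizontally strictly ordered `u ∈ (ℝ²)⁴` satisfying
> `{y₁,y₂} ∋ 0`, `Ψ₂(u) := lim_n Φ₂^{(δ_n)}(u) = ∫ χ_u(a,b) dμ(a,b)`. Proof. […] split
> `Φ₂^{(δ_n)}(u) = P_n + N_n` […] Step 1: `N_n → 0` […] `μ_∞[{a = 2}] = 0` […] thanks to our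
> regularity estimate. Step 2: `P_n = ∫ f_n dμ_∞^{(δ_n)} → ∫ χ_u dμ`.

Both statements are proved here **conditionally on their external inputs**, which enter as
hypotheses: for Lemma 32, the full-plane limit `Φ_{CYL_L,2}(u) → Φ₂(u)` (Theorem
(thm:infinite_volume_6V)), the membership `μ_L ∈ 𝓜_{c,C}` (Lemma 30, i.e. the regularity
estimate) and the vague convergence `μ_L → μ_∞` (a convergence sub-sequence, Lemma 31 (i)); for
Lemma 34, the representation `Φ₂(u/δ_n) = ∫ χ^discr_{u/δ_n} dμ_∞` (Lemma 32) and
`μ_∞{a = 2} = 0` (the regularity estimate). The case `y₁ = 0` is treated directly; the case `y₂ = 0`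
follows from the pair-exchange symmetry `χ_{(x₁,y₁),(x₂,y₂)} = χ_{(x₂,y₂),(x₁,y₁)}` of both
integrands (`chiDiscr_swap`, `chiCont_swap`). The continuous cutoff `ψ(a) = (3-a)⁺ ∧ 1` replaces the indicator `𝟙{a ≤ 2}`
(they agree `μ_L`-a.e.).

* `norm_chiDiscr_le_min_inv` — `|χ^discr_u(a,b)| ≤ K (a ∧ 1/a)` on `(0,3]` for `y₁ = 0`, `x₁' ≥ 1`;
* `dklmSpaceM_compact_lt_top`, `null_Ioi_two_of_halfPlaneVagueTendsto` (`μ_∞{a > 2} = 0`);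
* **`fullPlane_spectral_representation` — Lemma 32 (conditional)**;
* **`scalingLimit_spectral_representation` — Lemma 34 (conditional)**: `Φ₂(u/δ_n) → ∫ χ_u dμ`;
* primed versions for `y₂ = 0`.

## References

* H. Duminil-Copin, K. K. Kozlowski, P. Lammers, I. Manolescu, arXiv:2603.06268 (2026), Part II,
  Lemma 32 and Lemma 34 (with their proofs). [DKLM2026SixVertexGFF]
-/

noncomputable section

open MeasureTheory Set Filter Topology

namespace Literature.Probability.LatticeModels.SixVertex

variable {c C : ℝ}

/-! ## 1. Domination of `χ^discr` itself (`y₁ = 0`) -/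

/-- The clamped integrand is dominated at scale one: `|χ^discr,clamp_u(a,b)| ≤ max(2x₁, 2/x₁')(a ∧ 1/a)`
on `ℝ_{>0} × ℝ` when `y₁ = 0`, `x₁' ≥ 1`. [cite: DKLM2026SixVertexGFF, Part II, proof of Lemma 34, Step 2] -/
theorem norm_chiDiscrClamp_le_min_inv (x₁ : ℕ) {x₁' : ℕ} (hx₁' : 1 ≤ x₁') (y₁' : ℤ) (x₂ : ℕ) (y₂ : ℤ) {p : ℝ × ℝ}
    (hp0 : 0 < p.1) :
    ‖chiDiscrClamp x₁ 0 x₁' y₁' x₂ y₂ p‖ ≤ max (2 * (x₁ : ℝ)) (2 / (x₁' : ℝ)) * min p.1 p.1⁻¹ := by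
  have h := norm_fScaled_le (fun _ => (1 : ℝ)) (fun _ => x₁) (fun _ => (0 : ℤ)) (fun _ => x₁') (fun _ => y₁')
    (fun _ => x₂) (fun _ => y₂) (n := 0) one_pos rfl (X₀ := x₁') (X₁ := x₁) (by exact_mod_cast hx₁')
    (by simp) (by simp) hp0
  simpa [fScaled] using h

/-- **`|χ^discr_u(a,b)| ≤ K (a ∧ 1/a)` for `0 < a ≤ 3`** when `y₁ = 0` and `x₁' ≥ 1`, with
`K = max(max(2x₁, 2/x₁'), 3·(2^{x₂}+1)·2^{x₁'}·(1+2^{x₁}))`.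
[cite: DKLM2026SixVertexGFF, Part II, proof of Lemma 32 ("`𝟙{a≤2}·χ^discr_u = O(a ∧ 1/a)`")] -/
theorem norm_chiDiscr_le_min_inv (x₁ : ℕ) {x₁' : ℕ} (hx₁' : 1 ≤ x₁') (y₁' : ℤ) (x₂ : ℕ) (y₂ : ℤ) {p : ℝ × ℝ}
    (hp0 : 0 < p.1) (hp3 : p.1 ≤ 3) :
    ‖chiDiscr x₁ 0 x₁' y₁' x₂ y₂ p‖ ≤
      max (max (2 * (x₁ : ℝ)) (2 / (x₁' : ℝ))) (3 * ((2 ^ x₂ + 1) * 2 ^ x₁' * (1 + 2 ^ x₁))) * min p.1 p.1⁻¹ := by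
  rcases le_or_gt p.1 1 with h1 | h1
  · rw [← chiDiscrClamp_of_le _ _ _ _ _ _ h1]
    exact (norm_chiDiscrClamp_le_min_inv x₁ hx₁' y₁' x₂ y₂ hp0).trans
      (mul_le_mul_of_nonneg_right (le_max_left _ _) (min_inv_pos hp0).le)
  · have hb : |1 - p.1| ≤ 2 := abs_le.2 ⟨by linarith, by linarith⟩
    have hph : ∀ y : ℤ, ‖Complex.exp (-(Complex.I * (p.2 : ℂ) * y))‖ = 1 := norm_cexp_neg_I_mul_mul p.2
    have hc1 : ‖(1 : ℂ) - p.1‖ = |1 - p.1| := by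
      rw [← Complex.ofReal_one, ← Complex.ofReal_sub, Complex.norm_real, Real.norm_eq_abs]
    have hpow : ∀ n : ℕ, ‖((1 : ℂ) - p.1) ^ n‖ ≤ 2 ^ n := fun n => by
      rw [norm_pow, hc1]; exact pow_le_pow_left₀ (abs_nonneg _) hb n
    have hK2 : ‖chiDiscr x₁ 0 x₁' y₁' x₂ y₂ p‖ ≤ (2 ^ x₂ + 1) * 2 ^ x₁' * (1 + 2 ^ x₁) := by
      unfold chiDiscr
      rw [norm_mul, norm_mul]
      gcongr
      · refine (norm_sub_le _ _).trans ?_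
        rw [norm_mul, hph, mul_one, norm_one]
        linarith [hpow x₂]
      · rw [norm_mul, hph, mul_one]; exact hpow x₁'
      · refine (norm_sub_le _ _).trans ?_
        rw [norm_one, norm_mul, hph, mul_one]
        linarith [hpow x₁]
    have hmin : (1 : ℝ) / 3 ≤ min p.1 p.1⁻¹ := by
      rw [min_eq_right ((inv_le_one_of_one_le₀ h1.le).trans h1.le), one_div, inv_le_inv₀ (by norm_num) hp0]
      exact hp3
    calc ‖chiDiscr x₁ 0 x₁' y₁' x₂ y₂ p‖ ≤ (2 ^ x₂ + 1) * 2 ^ x₁' * (1 + 2 ^ x₁) := hK2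
      _ = 3 * ((2 ^ x₂ + 1) * 2 ^ x₁' * (1 + 2 ^ x₁)) * (1 / 3) := by ring
      _ ≤ 3 * ((2 ^ x₂ + 1) * 2 ^ x₁' * (1 + 2 ^ x₁)) * min p.1 p.1⁻¹ := by gcongr
      _ ≤ _ := mul_le_mul_of_nonneg_right (le_max_right _ _) (min_inv_pos hp0).le

/-! ## 2. The continuous cutoff `ψ(a) = (3 - a)⁺ ∧ 1` -/

/-- The cutoff `ψ(a) := max 0 (min 1 (3 - a))`: `1` on `a ≤ 2`, `0` on `a ≥ 3`, values in `[0,1]`.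
[cite: DKLM2026SixVertexGFF, Part II, proof of Lemma 32 (the indicator `𝟙{a ≤ 2}`)] -/
def cutoffTwo (a : ℝ) : ℝ := max 0 (min 1 (3 - a))

/-- `ψ` is continuous. [folklore] -/
theorem continuous_cutoffTwo : Continuous cutoffTwo := by unfold cutoffTwo; fun_prop

/-- `ψ = 1` on `a ≤ 2`. [folklore] -/
theorem cutoffTwo_of_le {a : ℝ} (ha : a ≤ 2) : cutoffTwo a = 1 := by
  rw [cutoffTwo, min_eq_left (by linarith), max_eq_right zero_le_one]

/-- `ψ = 0` on `a ≥ 3`. [folklore] -/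
theorem cutoffTwo_of_ge {a : ℝ} (ha : 3 ≤ a) : cutoffTwo a = 0 := by
  rw [cutoffTwo, max_eq_left]
  exact (min_le_right _ _).trans (by linarith)

/-- `0 ≤ ψ ≤ 1`. [folklore] -/
theorem cutoffTwo_mem (a : ℝ) : cutoffTwo a ∈ Icc (0 : ℝ) 1 :=
  ⟨le_max_left _ _, max_le zero_le_one (min_le_left _ _)⟩

/-! ## 3. Finiteness on compacts and null sets for vague limits -/

/-- A measure in `𝓜_{c,C}` is finite on compact subsets of the half-plane.
[cite: DKLM2026SixVertexGFF, Part II, Definition 29 (i)] -/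
theorem dklmSpaceM_compact_lt_top {ν : Measure (ℝ × ℝ)} (h : ν ∈ dklmSpaceM c C) {K : Set (ℝ × ℝ)}
    (hK : IsCompact K) (hKU : K ⊆ {p : ℝ × ℝ | 0 < p.1}) : ν K < ⊤ := by
  set V : ℕ → Set (ℝ × ℝ) := fun J => {p : ℝ × ℝ | p.1 ∈ Ioo ((2 : ℝ) ^ (-(J : ℤ))) ((2 : ℝ) ^ (J : ℤ))} with hV
  have hVo : ∀ J, IsOpen (V J) := fun J => isOpen_Ioo.preimage continuous_fst
  have hcov : K ⊆ ⋃ J, V J := by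
    intro p hp
    have hp0 : 0 < p.1 := hKU hp
    obtain ⟨J₁, hJ₁⟩ := exists_pow_lt_of_lt_one hp0 (show (2⁻¹ : ℝ) < 1 by norm_num)
    obtain ⟨J₂, hJ₂⟩ := pow_unbounded_of_one_lt p.1 (one_lt_two (α := ℝ))
    refine mem_iUnion.2 ⟨max J₁ J₂, ?_, ?_⟩
    · calc (2 : ℝ) ^ (-((max J₁ J₂ : ℕ) : ℤ)) ≤ (2 : ℝ) ^ (-(J₁ : ℤ)) :=
            zpow_le_zpow_right₀ one_le_two (by simp)
        _ = (2⁻¹ : ℝ) ^ J₁ := by rw [zpow_neg, zpow_natCast, inv_pow]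
        _ < p.1 := hJ₁
    · calc p.1 < 2 ^ J₂ := hJ₂
        _ = (2 : ℝ) ^ (J₂ : ℤ) := (zpow_natCast _ _).symm
        _ ≤ (2 : ℝ) ^ ((max J₁ J₂ : ℕ) : ℤ) := zpow_le_zpow_right₀ one_le_two (by simp)
  have hdir : Directed (· ⊆ ·) V := by
    refine Monotone.directed_le fun i j hij p hp => ⟨lt_of_le_of_lt ?_ hp.1, hp.2.trans_le ?_⟩
    · exact zpow_le_zpow_right₀ one_le_two (by simpa using hij)
    · exact zpow_le_zpow_right₀ one_le_two (by simpa using hij)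
  obtain ⟨J, hJ⟩ := hK.elim_directed_cover V hVo hcov hdir
  calc ν K ≤ ν (V J) := measure_mono hJ
    _ ≤ ν {p : ℝ × ℝ | p.1 ∈ Icc ((2 : ℝ) ^ (-(J : ℤ))) ((2 : ℝ) ^ (J : ℤ))} :=
        measure_mono fun p hp => ⟨hp.1.le, hp.2.le⟩
    _ ≤ ((2 * J + 1 : ℕ) : ENNReal) * (2 * ENNReal.ofReal C) := dklmSpaceM_measure_aIcc_le h J
    _ < ⊤ := ENNReal.mul_lt_top (ENNReal.natCast_lt_top _) (ENNReal.mul_lt_top (by norm_num) ENNReal.ofReal_lt_top)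

/-- **`μ_∞[a > 2] = 0`**: if `ν_n{a ≥ 2} = 0` for all `n` and `ν_n → ν` vaguely with `ν ∈ 𝓜_{c,C}`,
then `ν{a > 2} = 0` ("inherited from the corresponding bound for the measures `μ_L`, by the
definition of `𝓜` and a second application of Lemma 31").
[cite: DKLM2026SixVertexGFF, Part II, proof of Lemma 32] -/
theorem null_Ioi_two_of_halfPlaneVagueTendsto {νs : ℕ → Measure (ℝ × ℝ)} {ν : Measure (ℝ × ℝ)}
    (hν : ν ∈ dklmSpaceM c C) (hv : HalfPlaneVagueTendsto νs ν) (hsupp : ∀ n, νs n {p : ℝ × ℝ | 2 ≤ p.1} = 0) :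
    ν {p : ℝ × ℝ | 2 < p.1} = 0 := by
  have hG : ∀ R : ℕ, ν {p : ℝ × ℝ | p.1 ∈ Ioo (2 : ℝ) R} = 0 := by
    intro R
    refine le_antisymm ?_ zero_le
    rw [← ENNReal.ofReal_zero]
    refine measure_le_of_halfPlaneVagueTendsto hv (fun K hK hKU => dklmSpaceM_compact_lt_top hν hK hKU)
      (isOpen_Ioo.preimage continuous_fst) (fun p hp => lt_trans two_pos hp.1) le_rfl fun n => ?_
    rw [ENNReal.ofReal_zero]
    exact (measure_mono_null (fun p hp => le_of_lt hp.1) (hsupp n)).le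
  have : {p : ℝ × ℝ | 2 < p.1} = ⋃ R : ℕ, {p : ℝ × ℝ | p.1 ∈ Ioo (2 : ℝ) R} := by
    ext p
    simp only [mem_setOf_eq, mem_iUnion, mem_Ioo]
    constructor
    · intro hp
      obtain ⟨R, hR⟩ := exists_nat_gt p.1
      exact ⟨R, hp, hR⟩
    · rintro ⟨R, hp, -⟩; exact hp
  rw [this]
  exact measure_iUnion_null hG

/-! ## 4. Lemma 32 (conditional on the full-plane limit) -/

/-- **Lemma 32 (conditional form)**, case `y₁ = 0`, `x₁' ≥ 1`: let `μ_L ∈ 𝓜_{c,C}` (Lemma 30) be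
supported on `{a < 2}` and converge vaguely to `μ_∞ ∈ 𝓜_{c,C}`, let `Φ_L = ∫ χ^discr_u dμ_L`
(Theorem 23) converge to the full-plane correlation `Φ₂` (Theorem (thm:infinite_volume_6V)). Then
`μ_∞{a > 2} = 0` and `Φ₂ = ∫ χ^discr_u dμ_∞`.
[cite: DKLM2026SixVertexGFF, Part II, Lemma 32] -/
theorem fullPlane_spectral_representation (hc : 0 < c) (hC : 0 ≤ C) {μL : ℕ → Measure (ℝ × ℝ)}
    (hM : ∀ n, μL n ∈ dklmSpaceM c C) {μinf : Measure (ℝ × ℝ)} (hμinf : μinf ∈ dklmSpaceM c C)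
    (hv : HalfPlaneVagueTendsto μL μinf) (hsupp : ∀ n, μL n {p : ℝ × ℝ | 2 ≤ p.1} = 0)
    (x₁ : ℕ) {x₁' : ℕ} (hx₁' : 1 ≤ x₁') (y₁' : ℤ) (x₂ : ℕ) (y₂ : ℤ)
    {Φ : ℕ → ℝ} (hΦ : ∀ n, ((Φ n : ℝ) : ℂ) = ∫ p, chiDiscr x₁ 0 x₁' y₁' x₂ y₂ p ∂μL n)
    {Φ₂ : ℝ} (hlim : Tendsto Φ atTop (𝓝 Φ₂)) :
    μinf {p : ℝ × ℝ | 2 < p.1} = 0 ∧ ((Φ₂ : ℝ) : ℂ) = ∫ p, chiDiscr x₁ 0 x₁' y₁' x₂ y₂ p ∂μinf := by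
  have hnull := null_Ioi_two_of_halfPlaneVagueTendsto hμinf hv hsupp
  refine ⟨hnull, ?_⟩
  set χ : ℝ × ℝ → ℂ := chiDiscr x₁ 0 x₁' y₁' x₂ y₂ with hχ
  set f : ℝ × ℝ → ℂ := fun p => (cutoffTwo p.1 : ℂ) * χ p with hf
  have hfc : Continuous f := by
    have : Continuous χ := by rw [hχ]; unfold chiDiscr; fun_prop
    exact (Complex.continuous_ofReal.comp (continuous_cutoffTwo.comp continuous_fst)).mul this
  -- domination
  set K : ℝ := max (max (2 * (x₁ : ℝ)) (2 / (x₁' : ℝ))) (3 * ((2 ^ x₂ + 1) * 2 ^ x₁' * (1 + 2 ^ x₁))) with hK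
  have hfK : ∀ p : ℝ × ℝ, 0 < p.1 → ‖f p‖ ≤ K * min p.1 p.1⁻¹ := by
    intro p hp
    rcases le_or_gt p.1 3 with h3 | h3
    · rw [hf]; dsimp only
      rw [norm_mul, Complex.norm_real, Real.norm_eq_abs, abs_of_nonneg (cutoffTwo_mem p.1).1]
      calc cutoffTwo p.1 * ‖χ p‖ ≤ 1 * ‖χ p‖ := by gcongr; exact (cutoffTwo_mem p.1).2
        _ = ‖χ p‖ := one_mul _
        _ ≤ K * min p.1 p.1⁻¹ := norm_chiDiscr_le_min_inv x₁ hx₁' y₁' x₂ y₂ hp h3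
    · rw [hf]; dsimp only
      rw [cutoffTwo_of_ge h3.le, Complex.ofReal_zero, zero_mul, norm_zero]
      exact mul_nonneg (le_max_of_le_left (le_max_of_le_right (by positivity))) (min_inv_pos hp).le
  -- `f = χ` a.e. for every `μ_L` and for `μ_∞`
  have hae : ∀ ν : Measure (ℝ × ℝ), ν {p : ℝ × ℝ | 2 < p.1} = 0 → (fun p => f p) =ᵐ[ν] χ := by
    intro ν hν0
    have : ∀ᵐ p ∂ν, p ∉ {p : ℝ × ℝ | 2 < p.1} := compl_mem_ae_iff.2 hν0
    filter_upwards [this] with p hp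
    simp only [not_lt] at hp
    rw [hf]; dsimp only
    rw [cutoffTwo_of_le hp, Complex.ofReal_one, one_mul]
  have h1 : ∀ n, ∫ p, f p ∂μL n = ((Φ n : ℝ) : ℂ) := fun n => by
    rw [hΦ n]
    have hsub : {p : ℝ × ℝ | 2 < p.1} ⊆ {p : ℝ × ℝ | 2 ≤ p.1} := fun p (hp : (2 : ℝ) < p.1) => (hp.le : (2 : ℝ) ≤ p.1)
    exact integral_congr_ae (hae _ (measure_mono_null hsub (hsupp n)))
  -- Lemma 31 (ii)
  have hT := dklmSpaceM_tendsto_integral_of_vague hc hC hM hμinf hv hfc.continuousOn hfK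
  simp only [h1] at hT
  have hT' : Tendsto (fun n => ((Φ n : ℝ) : ℂ)) atTop (𝓝 ((Φ₂ : ℝ) : ℂ)) :=
    (Complex.continuous_ofReal.tendsto _).comp hlim
  rw [tendsto_nhds_unique hT' hT]
  exact integral_congr_ae (hae _ hnull)

/-! ## 5. Lemma 34 (conditional on Lemma 32 and `μ_∞{a = 2} = 0`) -/

/-- **Lemma 34 (conditional form)**, case `y₁ = 0`: let `(δ_n)` be a convergence sequence for
`μ_∞ ∈ 𝓜_{c,C}` with limit `μ ∈ 𝓜_{c,C}`, `μ_∞{a = 2} = 0` (regularity) and `μ_∞{a > 2} = 0`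
(Lemma 32); let the lattice data `u/δ_n` be horizontally strictly ordered with `y₁ = 0`
(`δ_n kx_i(n) → x_i`, `δ_n ky_i(n) → y_i`, `δ_n kx₁'(n) ≥ X₀ > 0`, `δ_n kx₁(n) ≤ X₁`) and let
`Φ₂(u/δ_n) = ∫ χ^discr_{u/δ_n} dμ_∞` (Lemma 32). Then
`Φ₂^{(δ_n)}(u) = Φ₂(u/δ_n) → ∫ χ_u dμ = Ψ₂(u)`.
[cite: DKLM2026SixVertexGFF, Part II, Lemma 34] -/
theorem scalingLimit_spectral_representation (hc : 0 < c) (hC : 0 ≤ C) {μinf μ : Measure (ℝ × ℝ)}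
    (hμinf : μinf ∈ dklmSpaceM c C) (hμ : μ ∈ dklmSpaceM c C) {δ : ℕ → ℝ} (hconv : IsConvergenceSeq μinf δ μ)
    (h2 : μinf {p : ℝ × ℝ | p.1 = 2} = 0) (h2' : μinf {p : ℝ × ℝ | 2 < p.1} = 0)
    {kx₁ kx₁' kx₂ : ℕ → ℕ} {ky₁' ky₂ : ℕ → ℤ} {x₁ x₁' y₁' x₂ y₂ : ℝ}
    (hx₁ : Tendsto (fun n => δ n * kx₁ n) atTop (𝓝 x₁)) (hx₁' : Tendsto (fun n => δ n * kx₁' n) atTop (𝓝 x₁'))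
    (hy₁' : Tendsto (fun n => δ n * ky₁' n) atTop (𝓝 y₁')) (hx₂ : Tendsto (fun n => δ n * kx₂ n) atTop (𝓝 x₂))
    (hy₂ : Tendsto (fun n => δ n * ky₂ n) atTop (𝓝 y₂))
    {X₀ X₁ : ℝ} (hX₀ : 0 < X₀) (hX₀n : ∀ n, X₀ ≤ δ n * kx₁' n) (hX₁n : ∀ n, δ n * kx₁ n ≤ X₁)
    {Φ : ℕ → ℝ} (hΦ : ∀ n, ((Φ n : ℝ) : ℂ) = ∫ p, chiDiscr (kx₁ n) 0 (kx₁' n) (ky₁' n) (kx₂ n) (ky₂ n) p ∂μinf) :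
    Tendsto (fun n => ((Φ n : ℝ) : ℂ)) atTop (𝓝 (∫ p, chiCont x₁ 0 x₁' y₁' x₂ y₂ p ∂μ)) := by
  obtain ⟨hδ0, hδ, hv⟩ := hconv
  have hkx₁' : ∀ n, 1 ≤ kx₁' n := by
    intro n
    by_contra h0
    push Not at h0
    have : kx₁' n = 0 := by omega
    have := hX₀n n
    rw [‹kx₁' n = 0›, Nat.cast_zero, mul_zero] at this
    linarith
  -- notation
  set χ : ℕ → ℝ × ℝ → ℂ := fun n => chiDiscr (kx₁ n) 0 (kx₁' n) (ky₁' n) (kx₂ n) (ky₂ n) with hχ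
  set S₂ : Set (ℝ × ℝ) := {p : ℝ × ℝ | p.1 ∈ Ioc 1 2} with hS₂
  have hS₂m : MeasurableSet S₂ := measurableSet_Ioc.preimage measurable_fst
  have hS₂fin : μinf S₂ < ⊤ := by
    have : S₂ = aStrip 0 := by
      ext p; simp [hS₂, aStrip]
    rw [this]
    exact (dklmSpaceM_measure_dyadic_le hμinf 0).trans_lt (ENNReal.mul_lt_top (by norm_num) ENNReal.ofReal_lt_top)
  -- the two pieces
  set P : ℕ → ℂ := fun n => ∫ p, chiDiscrClamp (kx₁ n) 0 (kx₁' n) (ky₁' n) (kx₂ n) (ky₂ n) p ∂μinf with hP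
  set N : ℕ → ℂ := fun n => ∫ p in S₂, χ n p ∂μinf with hN
  have hclamp_int : ∀ n, Integrable (chiDiscrClamp (kx₁ n) 0 (kx₁' n) (ky₁' n) (kx₂ n) (ky₂ n)) μinf := fun n =>
    dklmSpaceM_integrable hμinf (continuous_chiDiscrClamp _ _ _ _ _ _).continuousOn (K := max (2 * (kx₁ n : ℝ)) (2 / (kx₁' n : ℝ)))
      (le_max_of_le_left (by positivity)) fun p hp => norm_chiDiscrClamp_le_min_inv _ (hkx₁' n) _ _ _ hp
  have hS₂_int : ∀ n, Integrable (S₂.indicator (χ n)) μinf := by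
    intro n
    rw [integrable_indicator_iff hS₂m]
    refine Measure.integrableOn_of_bounded hS₂fin.ne (Continuous.aestronglyMeasurable (by
      rw [hχ]; unfold chiDiscr; fun_prop)) (M := 4) ?_
    rw [ae_restrict_iff' hS₂m]
    refine ae_of_all _ fun p hp => ?_
    refine (norm_chiDiscr_le_pow _ _ _ _ _ _ (by linarith [hp.1]) hp.2).trans ?_
    have : |1 - p.1| ^ kx₁' n ≤ 1 := pow_le_one₀ (abs_nonneg _) (abs_le.2 ⟨by linarith [hp.2], by linarith [hp.1]⟩)
    linarith
  -- decomposition `Φ_n = P_n + N_n`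
  have hdec : ∀ n, ((Φ n : ℝ) : ℂ) = P n + N n := by
    intro n
    rw [hΦ n, hP, hN]
    dsimp only
    rw [← integral_indicator hS₂m, ← integral_add (hclamp_int n) (hS₂_int n)]
    refine integral_congr_ae ?_
    have : ∀ᵐ p ∂μinf, p ∉ {p : ℝ × ℝ | 2 < p.1} := compl_mem_ae_iff.2 h2'
    filter_upwards [this] with p hp
    simp only [not_lt] at hp
    rw [← indicator_chiDiscr_eq_chiDiscrClamp _ _ (hkx₁' n)]
    by_cases h1 : p.1 ≤ 1
    · rw [indicator_of_mem (show p ∈ {p : ℝ × ℝ | p.1 ≤ 1} from h1),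
        indicator_of_notMem (show p ∉ S₂ from fun h => not_lt.2 h1 h.1), add_zero]
    · rw [indicator_of_notMem (show p ∉ {p : ℝ × ℝ | p.1 ≤ 1} from h1),
        indicator_of_mem (show p ∈ S₂ from ⟨not_le.1 h1, hp⟩), zero_add]
  simp only [hdec]
  rw [← add_zero (∫ p, chiCont x₁ 0 x₁' y₁' x₂ y₂ p ∂μ)]
  refine Tendsto.add ?_ ?_
  · -- Step 2: `P_n = ∫ f_n dμ_∞^{(δ_n)} → ∫ χ_u dμ`
    have hPeq : ∀ n, P n = ∫ p, fScaled δ kx₁ (fun _ => (0 : ℤ)) kx₁' ky₁' kx₂ ky₂ n p ∂scaleMeasure (δ n) μinf := by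
      intro n
      rw [hP]
      dsimp only
      rw [integral_scaleMeasure (δ n) μinf
        ((continuous_fScaled δ kx₁ (fun _ => (0 : ℤ)) kx₁' ky₁' kx₂ ky₂ n).aestronglyMeasurable)]
      refine integral_congr_ae (ae_of_all _ fun p => ?_)
      simp only [fScaled, Prod.smul_fst, Prod.smul_snd, smul_eq_mul, ← mul_assoc, mul_inv_cancel₀ (hδ0 n).ne',
        one_mul, Prod.mk.eta]
    rw [show P = fun n => ∫ p, fScaled δ kx₁ (fun _ => (0 : ℤ)) kx₁' ky₁' kx₂ ky₂ n p ∂scaleMeasure (δ n) μinf from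
      funext hPeq]
    exact tendsto_integral_fScaled hc hC (fun n => scaleMeasure_mem_dklmSpaceM (hδ0 n) hμinf) hμ hv hδ0 hδ hx₁
      (fun _ => rfl) hx₁' hy₁' hx₂ hy₂ hX₀ hX₀n hX₁n
  · -- Step 1: `N_n → 0`
    have hk : Tendsto kx₁' atTop atTop := by
      rw [← tendsto_natCast_atTop_iff (R := ℝ)]
      have hinv : Tendsto (fun n => X₀ * (δ n)⁻¹) atTop atTop := by
        refine Tendsto.const_mul_atTop hX₀ (tendsto_inv_nhdsGT_zero.comp ?_)
        exact tendsto_nhdsWithin_of_tendsto_nhds_of_eventually_within _ hδ (Eventually.of_forall hδ0)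
      refine tendsto_atTop_mono (fun n => ?_) hinv
      rw [mul_inv_le_iff₀ (hδ0 n), mul_comm]
      exact hX₀n n
    exact tendsto_setIntegral_chiDiscr_Ioc_zero hS₂fin h2 kx₁ (fun _ => (0 : ℤ)) hk ky₁' kx₂ ky₂

/-! ## 6. The case `y₂ = 0` by the symmetry `(x₁,y₁) ↔ (x₂,y₂)` of the integrands -/

/-- **`χ^discr` is symmetric under exchanging the two pairs**: `(x₁,y₁) ↔ (x₂,y₂)` (the outer factors
`(A₂ - 1)(1 - A₁) = (A₁ - 1)(1 - A₂)`). [cite: DKLM2026SixVertexGFF, Part II, eq. (def_chi_tilde)] -/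
theorem chiDiscr_swap (x₁ : ℕ) (y₁ : ℤ) (x₁' : ℕ) (y₁' : ℤ) (x₂ : ℕ) (y₂ : ℤ) :
    chiDiscr x₁ y₁ x₁' y₁' x₂ y₂ = chiDiscr x₂ y₂ x₁' y₁' x₁ y₁ := by
  funext p
  simp only [chiDiscr]
  ring

/-- **`χ_u` is symmetric under exchanging the two pairs.** [cite: DKLM2026SixVertexGFF, Part II, eq. (chi_u_def)] -/
theorem chiCont_swap (x₁ y₁ x₁' y₁' x₂ y₂ : ℝ) :
    chiCont x₁ y₁ x₁' y₁' x₂ y₂ = chiCont x₂ y₂ x₁' y₁' x₁ y₁ := by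
  funext p
  simp only [chiCont]
  ring

/-- **Lemma 32 (conditional form), case `y₂ = 0`**, by the pair-exchange symmetry.
[cite: DKLM2026SixVertexGFF, Part II, Lemma 32] -/
theorem fullPlane_spectral_representation' (hc : 0 < c) (hC : 0 ≤ C) {μL : ℕ → Measure (ℝ × ℝ)}
    (hM : ∀ n, μL n ∈ dklmSpaceM c C) {μinf : Measure (ℝ × ℝ)} (hμinf : μinf ∈ dklmSpaceM c C)
    (hv : HalfPlaneVagueTendsto μL μinf) (hsupp : ∀ n, μL n {p : ℝ × ℝ | 2 ≤ p.1} = 0)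
    (x₁ : ℕ) (y₁ : ℤ) {x₁' : ℕ} (hx₁' : 1 ≤ x₁') (y₁' : ℤ) (x₂ : ℕ)
    {Φ : ℕ → ℝ} (hΦ : ∀ n, ((Φ n : ℝ) : ℂ) = ∫ p, chiDiscr x₁ y₁ x₁' y₁' x₂ 0 p ∂μL n)
    {Φ₂ : ℝ} (hlim : Tendsto Φ atTop (𝓝 Φ₂)) :
    μinf {p : ℝ × ℝ | 2 < p.1} = 0 ∧ ((Φ₂ : ℝ) : ℂ) = ∫ p, chiDiscr x₁ y₁ x₁' y₁' x₂ 0 p ∂μinf := by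
  rw [chiDiscr_swap]
  simp only [chiDiscr_swap x₁ y₁] at hΦ
  exact fullPlane_spectral_representation hc hC hM hμinf hv hsupp x₂ hx₁' y₁' x₁ y₁ hΦ hlim

/-- **Lemma 34 (conditional form), case `y₂ = 0`**, by the pair-exchange symmetry (the width bound
now concerns the second pair: `δ_n kx₂(n) ≤ X₂`). [cite: DKLM2026SixVertexGFF, Part II, Lemma 34] -/
theorem scalingLimit_spectral_representation' (hc : 0 < c) (hC : 0 ≤ C) {μinf μ : Measure (ℝ × ℝ)}
    (hμinf : μinf ∈ dklmSpaceM c C) (hμ : μ ∈ dklmSpaceM c C) {δ : ℕ → ℝ} (hconv : IsConvergenceSeq μinf δ μ)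
    (h2 : μinf {p : ℝ × ℝ | p.1 = 2} = 0) (h2' : μinf {p : ℝ × ℝ | 2 < p.1} = 0)
    {kx₁ kx₁' kx₂ : ℕ → ℕ} {ky₁ ky₁' : ℕ → ℤ} {x₁ y₁ x₁' y₁' x₂ : ℝ}
    (hx₁ : Tendsto (fun n => δ n * kx₁ n) atTop (𝓝 x₁)) (hy₁ : Tendsto (fun n => δ n * ky₁ n) atTop (𝓝 y₁))
    (hx₁' : Tendsto (fun n => δ n * kx₁' n) atTop (𝓝 x₁')) (hy₁' : Tendsto (fun n => δ n * ky₁' n) atTop (𝓝 y₁'))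
    (hx₂ : Tendsto (fun n => δ n * kx₂ n) atTop (𝓝 x₂))
    {X₀ X₂ : ℝ} (hX₀ : 0 < X₀) (hX₀n : ∀ n, X₀ ≤ δ n * kx₁' n) (hX₂n : ∀ n, δ n * kx₂ n ≤ X₂)
    {Φ : ℕ → ℝ} (hΦ : ∀ n, ((Φ n : ℝ) : ℂ) = ∫ p, chiDiscr (kx₁ n) (ky₁ n) (kx₁' n) (ky₁' n) (kx₂ n) 0 p ∂μinf) :
    Tendsto (fun n => ((Φ n : ℝ) : ℂ)) atTop (𝓝 (∫ p, chiCont x₁ y₁ x₁' y₁' x₂ 0 p ∂μ)) := by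
  rw [chiCont_swap]
  simp only [chiDiscr_swap (kx₁ _) (ky₁ _)] at hΦ
  exact scalingLimit_spectral_representation hc hC hμinf hμ hconv h2 h2' hx₂ hx₁' hy₁' hx₁ hy₁ hX₀ hX₀n hX₂n hΦ

end Literature.Probability.LatticeModels.SixVertex

end
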